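import Mathlib

/-!
# Imbrie (2016), Assumption LLA: the exact two-level engine — an affine 2×2 family has a small gap only on a short interval

CITATION HEADER (lean-in-tree rule 2026-08-18). J. Z. Imbrie, *On many-body localization for quantum spin chains*,
J. Stat. Phys. **163** (2016) 998–1048, doi 10.1007/s10955-016-1508-x, arXiv:1403.7837 [ImbrieJSP2016], eq. (1.1) (the random
couplings h_i, J_i, Γ_i enter the Hamiltonian LINEARLY), eq. (1.3) (Assumption LLA(ν, C): P(min gap < δ) ≤ Cⁿ δ^ν).

WHAT IS PROVED (a lemma of the audit cell `pub-imbrie`, NOT a statement of the paper; it is the remainder-free core of pub-imbrie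
LLA.md gen-4 (G3)/V15 "G²-convexity", made exact).  A real symmetric 2×2 matrix `[[a, b], [b, c]]` has the two eigenvalues
`(a + c ± √((a−c)² + 4b²))/2` (`twoByTwo_eigenvalue_iff`: λ solves the characteristic equation iff it is one of them), so its level gap is
`√((a−c)² + 4b²)`.  Along an AFFINE one-parameter family `a = a₀ + t a₁, b = b₀ + t b₁, c = c₀ + t c₁` (one random coupling `t` moved, all
others frozen) the squared gap is a quadratic polynomial in `t` whose leading coefficient is the squared SPREAD of the velocity matrix,
`spr² = (a₁ − c₁)² + 4 b₁²`, and completing the square (`affine_sqGap_lower`) gives `gap(t)² ≥ spr² (t − t₀)²` for an explicit `t₀`.  Hence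
(`affine_twoLevel_smallGap_subset_Ioo`, `volume_affine_twoLevel_smallGap_le`)
  `Leb { t : ℝ | gap(t) < δ } ≤ 2δ / spr`,
and for any law of `t` with density ≤ ρ₀ (`measure_affine_twoLevel_smallGap_le`) the probability is ≤ ρ₀ · 2δ/spr: the LLA shape with the
optimal exponent ν = 1 for an EXACTLY two-level system, uniformly in the frozen data `(a₀, b₀, c₀)` — in particular uniformly in the size of the
off-diagonal ("tunnelling") entry, which is the point of (G3): no Weyl window, no 1/γ.  In the cell's level-velocity dictionary `a₁ − c₁ = V_vv − V_uu`
and `b₁ = V_uv` for the local direction V, so `spr` is the quantity bounded below by 4/3 on two sites (`TwoSiteSpreadLowerBound`) and shown to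
vanish from three sites on (`ThreeSiteSpread`).  What this file does NOT do: reduce an adjacent eigenpair of the 2ⁿ-level block Hamiltonian to such a
family — that reduction carries a remainder (the R_V of LLA.md (G3)) controlled only by the isolation of the pair, and its probabilistic control for
clusters is exactly the open residue (PND_r)/(M5).  STATUS: elementary; says NOTHING about whether LLA holds (OPEN, pub-imbrie LLA.md §7).
No `sorry`, no new axioms, no definitions.
-/

namespace Literature.MathematicalPhysics.QuantumLattice.Imbrie2016

open MeasureTheory Set

/-- The eigenvalues of the real symmetric matrix `[[a, b], [b, c]]`: `λ` is a root of the characteristic equation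
`(a − λ)(c − λ) − b² = 0` iff `λ = (a + c ± √((a−c)² + 4b²))/2`; in particular the level gap is `√((a−c)² + 4b²)`.
[cite: ImbrieJSP2016, eq. (1.1), (1.3)] -/
theorem twoByTwo_eigenvalue_iff (a b c x : ℝ) :
    (a - x) * (c - x) - b ^ 2 = 0 ↔
      x = (a + c + Real.sqrt ((a - c) ^ 2 + 4 * b ^ 2)) / 2 ∨ x = (a + c - Real.sqrt ((a - c) ^ 2 + 4 * b ^ 2)) / 2 := by
  set r := Real.sqrt ((a - c) ^ 2 + 4 * b ^ 2) with hr
  have hr2 : r ^ 2 = (a - c) ^ 2 + 4 * b ^ 2 := by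
    rw [hr, Real.sq_sqrt]; positivity
  have key : (a - x) * (c - x) - b ^ 2 = (x - (a + c + r) / 2) * (x - (a + c - r) / 2) := by
    linear_combination (1 / 4 : ℝ) * hr2
  rw [key, mul_eq_zero, sub_eq_zero, sub_eq_zero]

/-- The gap of `[[a, b], [b, c]]`: the difference of the two roots above is `√((a−c)² + 4b²) ≥ 0`. [cite: ImbrieJSP2016, eq. (1.3)] -/
theorem twoByTwo_gap_eq (a b c : ℝ) :
    (a + c + Real.sqrt ((a - c) ^ 2 + 4 * b ^ 2)) / 2 - (a + c - Real.sqrt ((a - c) ^ 2 + 4 * b ^ 2)) / 2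
      = Real.sqrt ((a - c) ^ 2 + 4 * b ^ 2) := by
  ring

/-- Completing the square along an affine family: with `B = β₁² + β₂²` and `p = α₁β₁ + α₂β₂`,
`B · ((α₁ + tβ₁)² + (α₂ + tβ₂)²) − (B t + p)² = (α₁β₂ − α₂β₁)² ≥ 0`.  Applied with `α₁ + tβ₁ = a(t) − c(t)`, `α₂ + tβ₂ = 2 b(t)` this is
`spr² · gap(t)² ≥ (spr² (t − t₀))²`, `t₀ = −p/spr²`. [cite: ImbrieJSP2016, eq. (1.1), (1.3)] -/
theorem affine_sqGap_lower (α₁ α₂ β₁ β₂ t : ℝ) :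
    ((β₁ ^ 2 + β₂ ^ 2) * t + (α₁ * β₁ + α₂ * β₂)) ^ 2
      ≤ (β₁ ^ 2 + β₂ ^ 2) * ((α₁ + t * β₁) ^ 2 + (α₂ + t * β₂) ^ 2) := by
  nlinarith [sq_nonneg (α₁ * β₂ - α₂ * β₁)]

/-- The small-gap set of an affine 2×2 family lies in an explicit interval of length `2δ/spr`:
if `√(((a₀+ta₁) − (c₀+tc₁))² + 4(b₀+tb₁)²) < δ` and `spr² = (a₁−c₁)² + 4b₁² > 0` then `|t − t₀| < δ/spr` with
`t₀ = −((a₀−c₀)(a₁−c₁) + 4 b₀b₁)/spr²`. [cite: ImbrieJSP2016, eq. (1.1), (1.3)] -/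
theorem affine_twoLevel_smallGap_subset_Ioo (a₀ a₁ b₀ b₁ c₀ c₁ δ : ℝ) (hδ : 0 < δ)
    (hspr : 0 < (a₁ - c₁) ^ 2 + 4 * b₁ ^ 2) :
    {t : ℝ | Real.sqrt (((a₀ + t * a₁) - (c₀ + t * c₁)) ^ 2 + 4 * (b₀ + t * b₁) ^ 2) < δ}
      ⊆ Ioo (-((a₀ - c₀) * (a₁ - c₁) + 4 * (b₀ * b₁)) / ((a₁ - c₁) ^ 2 + 4 * b₁ ^ 2)
              - δ / Real.sqrt ((a₁ - c₁) ^ 2 + 4 * b₁ ^ 2))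
            (-((a₀ - c₀) * (a₁ - c₁) + 4 * (b₀ * b₁)) / ((a₁ - c₁) ^ 2 + 4 * b₁ ^ 2)
              + δ / Real.sqrt ((a₁ - c₁) ^ 2 + 4 * b₁ ^ 2)) := by
  intro t ht
  simp only [mem_setOf_eq] at ht
  -- notation: B = spr², s = spr, p = ⟨α, β⟩ with α = (a₀ − c₀, 2b₀), β = (a₁ − c₁, 2b₁)
  set B : ℝ := (a₁ - c₁) ^ 2 + 4 * b₁ ^ 2 with hB
  set s : ℝ := Real.sqrt B with hs
  set p : ℝ := (a₀ - c₀) * (a₁ - c₁) + 4 * (b₀ * b₁) with hp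
  have hs_pos : 0 < s := Real.sqrt_pos.mpr hspr
  have hss : s * s = B := Real.mul_self_sqrt hspr.le
  -- gap < δ ⇒ gap² < δ²
  have hq : ((a₀ + t * a₁) - (c₀ + t * c₁)) ^ 2 + 4 * (b₀ + t * b₁) ^ 2 < δ ^ 2 := (Real.sqrt_lt' hδ).mp ht
  -- completing the square: (B t + p)² ≤ B · gap²
  have hcs' : (B * t + p) ^ 2 ≤ B * (((a₀ + t * a₁) - (c₀ + t * c₁)) ^ 2 + 4 * (b₀ + t * b₁) ^ 2) := by
    have hcs := affine_sqGap_lower (a₀ - c₀) (2 * b₀) (a₁ - c₁) (2 * b₁) t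
    have e1 : (a₁ - c₁) ^ 2 + (2 * b₁) ^ 2 = B := by rw [hB]; ring
    have e2 : (a₀ - c₀) * (a₁ - c₁) + 2 * b₀ * (2 * b₁) = p := by rw [hp]; ring
    have e3 : (a₀ - c₀ + t * (a₁ - c₁)) ^ 2 + (2 * b₀ + t * (2 * b₁)) ^ 2
        = ((a₀ + t * a₁) - (c₀ + t * c₁)) ^ 2 + 4 * (b₀ + t * b₁) ^ 2 := by ring
    rw [e1, e2, e3] at hcs
    exact hcs
  have hlt : (B * t + p) ^ 2 < (s * δ) ^ 2 := by
    have hBq : B * (((a₀ + t * a₁) - (c₀ + t * c₁)) ^ 2 + 4 * (b₀ + t * b₁) ^ 2) < B * δ ^ 2 :=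
      mul_lt_mul_of_pos_left hq hspr
    have hsd : (s * δ) ^ 2 = B * δ ^ 2 := by rw [mul_pow, sq, hss]
    rw [hsd]
    exact lt_of_le_of_lt hcs' hBq
  have habs : |B * t + p| < s * δ := abs_lt_of_sq_lt_sq hlt (by positivity)
  obtain ⟨h1, h2⟩ := abs_lt.mp habs
  have hB_pos : 0 < B := hspr
  -- δ/s = δ s / B, so the interval endpoints are (−p ∓ δ s)/B
  have eds : δ / s = δ * s / B := by
    rw [← hss]; exact (mul_div_mul_right δ s hs_pos.ne').symm
  rw [mem_Ioo]
  constructor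
  · have e : -p / B - δ / s = (-p - δ * s) / B := by rw [eds, div_sub_div_same]
    rw [e, div_lt_iff₀ hB_pos]
    linarith [h1]
  · have e : -p / B + δ / s = (-p + δ * s) / B := by rw [eds, ← add_div]
    rw [e, lt_div_iff₀ hB_pos]
    linarith [h2]

/-- LLA shape with the optimal exponent for an exactly two-level affine family: the Lebesgue measure of the couplings `t` at which the gap of
`[[a₀+ta₁, b₀+tb₁], [b₀+tb₁, c₀+tc₁]]` is `< δ` is at most `2δ/spr`, `spr = √((a₁−c₁)² + 4b₁²)`, uniformly in the frozen data (a₀, b₀, c₀).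
[cite: ImbrieJSP2016, eq. (1.3)] -/
theorem volume_affine_twoLevel_smallGap_le (a₀ a₁ b₀ b₁ c₀ c₁ δ : ℝ) (hδ : 0 < δ)
    (hspr : 0 < (a₁ - c₁) ^ 2 + 4 * b₁ ^ 2) :
    volume {t : ℝ | Real.sqrt (((a₀ + t * a₁) - (c₀ + t * c₁)) ^ 2 + 4 * (b₀ + t * b₁) ^ 2) < δ}
      ≤ ENNReal.ofReal (2 * δ / Real.sqrt ((a₁ - c₁) ^ 2 + 4 * b₁ ^ 2)) := by
  refine (measure_mono (affine_twoLevel_smallGap_subset_Ioo a₀ a₁ b₀ b₁ c₀ c₁ δ hδ hspr)).trans ?_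
  rw [Real.volume_Ioo]
  apply le_of_eq
  congr 1
  ring

/-- The same for any law `μ` of the moved coupling with density at most `ρ₀` (`μ ≤ ρ₀ · Leb`, the hypothesis of Imbrie's (1.1)):
`μ {gap < δ} ≤ ρ₀ · 2δ/spr`. [cite: ImbrieJSP2016, eq. (1.1), (1.3)] -/
theorem measure_affine_twoLevel_smallGap_le (μ : Measure ℝ) (ρ₀ : ℝ) (hμ : μ ≤ (ENNReal.ofReal ρ₀) • (volume : Measure ℝ))
    (a₀ a₁ b₀ b₁ c₀ c₁ δ : ℝ) (hδ : 0 < δ) (hspr : 0 < (a₁ - c₁) ^ 2 + 4 * b₁ ^ 2) :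
    μ {t : ℝ | Real.sqrt (((a₀ + t * a₁) - (c₀ + t * c₁)) ^ 2 + 4 * (b₀ + t * b₁) ^ 2) < δ}
      ≤ ENNReal.ofReal ρ₀ * ENNReal.ofReal (2 * δ / Real.sqrt ((a₁ - c₁) ^ 2 + 4 * b₁ ^ 2)) := by
  refine (Measure.le_iff'.mp hμ _).trans ?_
  rw [Measure.smul_apply, smul_eq_mul]
  gcongr
  exact volume_affine_twoLevel_smallGap_le a₀ a₁ b₀ b₁ c₀ c₁ δ hδ hspr

end Literature.MathematicalPhysics.QuantumLattice.Imbrie2016
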